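import Literature.MathematicalPhysics.QuantumFieldTheory.Balaban1983to89.StrongCouplingDobrushinWindow
import Literature.MathematicalPhysics.QuantumFieldTheory.PlaquetteWeightTorusSpecification
import Literature.MathematicalPhysics.QuantumFieldTheory.TiltedExponentMorseBounds
import HarnessLib

/-!
# Venture YMGap, track (a) / A4, part 1 — the Durhuus–Fröhlich SLAB σ-model of `SU(N)` lattice Yang–Mills as a
# finite-volume Gibbs specification: one-site law, site field, radius and influence bounds

HONEST FRAMING: venture file of the cell `pub-ymgap` (QuantumFields programme). It formalises the finite-volume
slab σ-model used by Durhuus–Fröhlich (CMP 75 (1980)) and by Cao–Nissim–Sheffield (arXiv:2509.04688, Def. 2.1,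
Thm. 2.3) to derive the Wilson AREA LAW at strong coupling, and prepares the «Dobrushin door» for it (sibling file
`SlabDobrushinDoor`): here the model, its Gibbsian specification, the one-site conditional law as a tilted Haar
measure `∝ exp(N Re tr(g B_x(ω)))`, `‖B_x(ω)‖_op ≤ 2n|β|` and `‖B_x(ω) − B_x(η)‖_F ≤ |β| m(x,y) ‖ω_y − η_y‖_F`.  Strong-coupling LATTICE statement only; no continuum limit, no mass-gap or
Clay claim; the area-law conclusion itself is NOT drawn in this file (it needs DF80/CNS25 Thm. 2.3 as a named
Literature fact, to be supplied by the cell's lit seat).  Specification of the task: `HOME/p2/SLAB-DOOR.md`.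

Model (CNS25 Def. 2.1, 't Hooft scaling): slice `Λ = (ℤ/L)^n` (`n = d-1`), spins `Q_x ∈ SU(N)`, positively
oriented edges `e = (x, i)` from `x` to `x + e_i`, boundary fields `A_e, B_e ∈ U(N)`,
`S_{A,B}(Q) = N β ∑_e Re tr(Q_x A_e Q_{x+e_i}⁻¹ B_e⁻¹)`, `μ_{A,B} ∝ exp(S_{A,B}) ∏ dQ_x`.
-/

noncomputable section

open MeasureTheory Filter Topology Function ProbabilityTheory
open scoped NNReal Matrix
open Literature.Probability.LatticeModels Literature.Probability.LatticeModels.DobrushinMetric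
open Literature.MathematicalPhysics.QuantumLattice
open Literature.MathematicalPhysics.QuantumFieldTheory
open Literature.MathematicalPhysics.QuantumFieldTheory.Balaban1983to89.StrongCouplingDobrushinWindow

namespace Summit.Ventures.YMGap.Slab

variable {n L N : ℕ} [NeZero L]

/-- `SU(N)` as a type (matrix special unitary group). [folklore] -/
abbrev SU (N : ℕ) : Type := Matrix.specialUnitaryGroup (Fin N) ℂ

/-- Positively oriented nearest-neighbour edges `(x, i)` of the slice `(ℤ/L)^n`, from `x` to `x + e_i`.
[cite: CaoNissimSheffield2025dynamical, Def. 2.1] -/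
abbrev SlabEdge (n L : ℕ) : Type := TorusSite n L × Fin n

/-- The endpoint `x + e_i` of the edge `(x, i)`. [cite: CaoNissimSheffield2025dynamical, Def. 2.1] -/
def SlabEdge.tgt (e : SlabEdge n L) : TorusSite n L := Function.update e.1 e.2 (e.1 e.2 + 1)

/-- A slab spin configuration: one `SU(N)` matrix per slice site (the vertical links of one slab).
[cite: CaoNissimSheffield2025dynamical, Def. 2.1] -/
abbrev SlabConfig (n L N : ℕ) : Type := TorusSite n L → SU N

/-- The slab energy `S_{A,B}(Q) = N β ∑_e Re tr(Q_x A_e Q_{x+e_i}^* B_e^*)` ('t Hooft coupling `β`; boundary fields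
`A, B` are arbitrary unitary matrices). [cite: CaoNissimSheffield2025dynamical, Def. 2.1] -/
def slabEnergy (N : ℕ) (β : ℝ) (A B : SlabEdge n L → Matrix.unitaryGroup (Fin N) ℂ) (Q : SlabConfig n L N) : ℝ :=
  (N : ℝ) * β * ∑ e : SlabEdge n L,
    ((Q e.1 : Matrix (Fin N) (Fin N) ℂ) * (A e : Matrix (Fin N) (Fin N) ℂ) *
      (Q e.tgt : Matrix (Fin N) (Fin N) ℂ)ᴴ * (B e : Matrix (Fin N) (Fin N) ℂ)ᴴ).trace.re

/-- The slab energy is continuous in the spin configuration. [folklore] -/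
theorem continuous_slabEnergy (β : ℝ) (A B : SlabEdge n L → Matrix.unitaryGroup (Fin N) ℂ) :
    Continuous (slabEnergy (n := n) (L := L) N β A B) := by
  unfold slabEnergy
  refine continuous_const.mul (continuous_finsetSum _ fun e _ => ?_)
  refine Complex.continuous_re.comp ?_
  refine Continuous.matrix_trace ?_
  refine ((((continuous_subtype_val.comp (continuous_apply e.1)).matrix_mul continuous_const).matrix_mul
    ((continuous_subtype_val.comp (continuous_apply e.tgt)).matrix_conjTranspose)).matrix_mul continuous_const)

/-- The slab energy is measurable. [folklore] -/
theorem measurable_slabEnergy (β : ℝ) (A B : SlabEdge n L → Matrix.unitaryGroup (Fin N) ℂ) :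
    Measurable (slabEnergy (n := n) (L := L) N β A B) := by
  haveI : SecondCountableTopology (Matrix (Fin N) (Fin N) ℂ) :=
    inferInstanceAs (SecondCountableTopology (Fin N → Fin N → ℂ))
  haveI : SecondCountableTopology (SU N) := Topology.IsEmbedding.subtypeVal.secondCountableTopology
  exact (continuous_slabEnergy β A B).measurable

/-- The slab energy is bounded (compactness of `SU(N)^Λ`). [folklore] -/
theorem exists_abs_slabEnergy_le (β : ℝ) (A B : SlabEdge n L → Matrix.unitaryGroup (Fin N) ℂ) :
    ∃ C, ∀ Q : SlabConfig n L N, |slabEnergy N β A B Q| ≤ C := by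
  obtain ⟨C, hC⟩ := isCompact_univ.exists_bound_of_continuousOn (continuous_slabEnergy (n := n) (L := L) β A B).continuousOn
  exact ⟨C, fun Q => by simpa [Real.norm_eq_abs] using hC Q (Set.mem_univ Q)⟩

/-- The **slab specification** `γ_Λ(· | η) = (Haar^{⊗Λ} ⊗ δ_{η_{Λᶜ}}).tilted S_{A,B}` on the sites of the slice.
[cite: CaoNissimSheffield2025dynamical, Def. 2.1] [cite: Georgii2011, Def. 2.9] -/
def slabSpec (β : ℝ) (A B : SlabEdge n L → Matrix.unitaryGroup (Fin N) ℂ) : Specification (TorusSite n L) (SU N) :=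
  fun Λ η => ((Measure.pi fun _ : ↥Λ => haarProbability (SU N)).map (glueWith Λ · η)).tilted (slabEnergy N β A B)

/-- The slab specification is a Gibbsian specification (generic tilted finite-system construction).
[cite: Georgii2011, Def. 2.9] -/
theorem isSpecification_slabSpec (β : ℝ) (A B : SlabEdge n L → Matrix.unitaryGroup (Fin N) ℂ) :
    IsSpecification (slabSpec (n := n) (L := L) β A B) := by
  haveI : SecondCountableTopology (Matrix (Fin N) (Fin N) ℂ) :=
    inferInstanceAs (SecondCountableTopology (Fin N → Fin N → ℂ))
  haveI : SecondCountableTopology (SU N) := Topology.IsEmbedding.subtypeVal.secondCountableTopology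
  haveI : NeZero (haarProbability (SU N)) := ⟨IsProbabilityMeasure.ne_zero _⟩
  obtain ⟨C, hC⟩ := exists_abs_slabEnergy_le (n := n) (L := L) β A B
  exact isSpecification_tilted_map_glueWith_pi (V := TorusSite n L) (S := SU N) (haarProbability (SU N))
    (φ := fun _ => slabEnergy N β A B) (fun _ => measurable_slabEnergy β A B)
    (fun _ => ⟨C, hC⟩) (fun _ _ _ σ σ' _ => by simp)

/-- The **slab measure** `μ_{A,B}` = the full-volume kernel of the slab specification (any boundary condition; the
slice has no outside). [cite: CaoNissimSheffield2025dynamical, Def. 2.1] -/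
def slabMeasure (β : ℝ) (A B : SlabEdge n L → Matrix.unitaryGroup (Fin N) ℂ) : Measure (SlabConfig n L N) :=
  slabSpec β A B Finset.univ fun _ => 1

/-- The slab measure is a Gibbs measure of the slab specification (finite system: DLR = consistency).
[cite: Georgii2011, Def. 1.23 / Rem. 1.24] -/
theorem isGibbsMeasure_slabMeasure (β : ℝ) (A B : SlabEdge n L → Matrix.unitaryGroup (Fin N) ℂ) :
    IsGibbsMeasure (slabSpec (n := n) (L := L) β A B) (slabMeasure β A B) := by
  classical
  have hγ := isSpecification_slabSpec (n := n) (L := L) β A B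
  refine ⟨hγ.isProbability _ _, fun Λ S hS => ?_⟩
  exact hγ.consistent (Finset.subset_univ Λ) _ S hS

/-! ### The one-site conditional law: a tilted Haar measure -/

/-- **The one-site conditional law of the slab specification is the Haar measure tilted by the energy section**
`g ↦ S_{A,B}(ω^{x ← g})`. [cite: Georgii2011, Def. 2.9] -/
theorem siteLaw_slabSpec_eq_tilted (β : ℝ) (A B : SlabEdge n L → Matrix.unitaryGroup (Fin N) ℂ)
    (x : TorusSite n L) (ω : SlabConfig n L N) :
    siteLaw (slabSpec β A B) x ω =
      (haarProbability (SU N)).tilted fun g => slabEnergy N β A B (Function.update ω x g) := by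
  classical
  have hF : Measurable (slabEnergy (n := n) (L := L) N β A B) := measurable_slabEnergy β A B
  have h1 : slabSpec β A B {x} ω =
      ((Measure.pi fun _ : ↥({x} : Finset (TorusSite n L)) => haarProbability (SU N)).tilted
        (slabEnergy N β A B ∘ fun ζ => glueWith {x} ζ ω)).map (fun ζ => glueWith {x} ζ ω) := by
    unfold slabSpec
    rw [map_tilted_comp _ (measurable_glueWith _ ω) hF]
  have hgl : (fun ζ : ↥({x} : Finset (TorusSite n L)) → SU N => glueWith {x} ζ ω) =
      Function.update ω x ∘ fun ζ => ζ ⟨x, Finset.mem_singleton_self x⟩ := by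
    funext ζ z
    by_cases hz : z = x
    · subst hz
      simp
    · rw [Function.comp_apply, Function.update_of_ne hz,
        glueWith_apply_not_mem _ _ _ (by simpa using hz)]
  have hev : (Measure.pi fun _ : ↥({x} : Finset (TorusSite n L)) => haarProbability (SU N)).map
      (fun ζ => ζ ⟨x, Finset.mem_singleton_self x⟩) = haarProbability (SU N) :=
    (MeasureTheory.measurePreserving_eval (fun _ : ↥({x} : Finset (TorusSite n L)) =>
      haarProbability (SU N)) ⟨x, Finset.mem_singleton_self x⟩).map_eq
  have hF' : Measurable fun g : SU N => slabEnergy N β A B (Function.update ω x g) :=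
    hF.comp (measurable_update ω)
  have key := map_tilted_comp (Measure.pi fun _ : ↥({x} : Finset (TorusSite n L)) => haarProbability (SU N))
    (measurable_pi_apply (⟨x, Finset.mem_singleton_self x⟩ : ↥({x} : Finset (TorusSite n L)))) hF'
  rw [hev] at key
  rw [siteLaw, h1, Measure.map_map (measurable_pi_apply x) (measurable_glueWith _ ω), hgl]
  have hcomp : (slabEnergy N β A B ∘ Function.update ω x ∘ fun ζ : ↥({x} : Finset (TorusSite n L)) → SU N =>
        ζ ⟨x, Finset.mem_singleton_self x⟩) =
      (fun g => slabEnergy N β A B (Function.update ω x g)) ∘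
        fun ζ : ↥({x} : Finset (TorusSite n L)) → SU N => ζ ⟨x, Finset.mem_singleton_self x⟩ := rfl
  have hcomp' : ((fun σ : SlabConfig n L N => σ x) ∘ Function.update ω x ∘
      fun ζ : ↥({x} : Finset (TorusSite n L)) → SU N => ζ ⟨x, Finset.mem_singleton_self x⟩) =
      fun ζ : ↥({x} : Finset (TorusSite n L)) → SU N => ζ ⟨x, Finset.mem_singleton_self x⟩ := by
    funext ζ; simp
  rw [hcomp, hcomp']
  exact key

/-! ### The site field `B_x(ω)` (the slab analogue of the staple field) -/

/-- Outgoing edges `(x, i)` at the site `x`. [cite: CaoNissimSheffield2025dynamical, Def. 2.1] -/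
def outEdges (x : TorusSite n L) : Finset (SlabEdge n L) := Finset.univ.filter fun e => e.1 = x

/-- Incoming edges `(x - e_i, i)` at the site `x`. [cite: CaoNissimSheffield2025dynamical, Def. 2.1] -/
def inEdges (x : TorusSite n L) : Finset (SlabEdge n L) := Finset.univ.filter fun e => e.tgt = x

/-- The **slab staple sum** at `x`: `∑_{e=(x,y)} A_e ω_y^* B_e^* + ∑_{e=(y,x)} A_e^* ω_y^* B_e` (p2/SLAB-DOOR (S1)). [folklore] -/
def slabStapleSum (A B : SlabEdge n L → Matrix.unitaryGroup (Fin N) ℂ) (ω : SlabConfig n L N)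
    (x : TorusSite n L) : Matrix (Fin N) (Fin N) ℂ :=
  (∑ e ∈ outEdges x, (A e : Matrix (Fin N) (Fin N) ℂ) * (ω e.tgt : Matrix (Fin N) (Fin N) ℂ)ᴴ *
      (B e : Matrix (Fin N) (Fin N) ℂ)ᴴ) +
    ∑ e ∈ inEdges x, (A e : Matrix (Fin N) (Fin N) ℂ)ᴴ * (ω e.1 : Matrix (Fin N) (Fin N) ℂ)ᴴ *
      (B e : Matrix (Fin N) (Fin N) ℂ)

/-- The **slab site field** `B_x(ω) = β · slabStapleSum`: the one-site law at `x` is `∝ exp(N Re tr(g B_x(ω))) dg`.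
[folklore] -/
def slabField (β : ℝ) (A B : SlabEdge n L → Matrix.unitaryGroup (Fin N) ℂ) (ω : SlabConfig n L N)
    (x : TorusSite n L) : Matrix (Fin N) (Fin N) ℂ :=
  (β : ℂ) • slabStapleSum A B ω x

/-- `Re tr M = Re tr Mᴴ`. [folklore] -/
theorem re_trace_conjTranspose (M : Matrix (Fin N) (Fin N) ℂ) : Mᴴ.trace.re = M.trace.re := by
  rw [Matrix.trace_conjTranspose, Complex.star_def, Complex.conj_re]

omit [NeZero L] in
/-- One edge term of the energy after updating the site `x`: the three cases (outgoing at `x`, incoming at `x`, not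
touching `x`), provided no edge is a loop. [folklore] -/
theorem edgeTerm_update (A B : SlabEdge n L → Matrix.unitaryGroup (Fin N) ℂ) (ω : SlabConfig n L N)
    (x : TorusSite n L) (g : SU N) (e : SlabEdge n L) (he : e.tgt ≠ e.1) :
    ((Function.update ω x g e.1 : Matrix (Fin N) (Fin N) ℂ) * (A e : Matrix (Fin N) (Fin N) ℂ) *
        (Function.update ω x g e.tgt : Matrix (Fin N) (Fin N) ℂ)ᴴ * (B e : Matrix (Fin N) (Fin N) ℂ)ᴴ).trace.re =
      (if e.1 = x then ((g : Matrix (Fin N) (Fin N) ℂ) * ((A e : Matrix (Fin N) (Fin N) ℂ) *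
          (ω e.tgt : Matrix (Fin N) (Fin N) ℂ)ᴴ * (B e : Matrix (Fin N) (Fin N) ℂ)ᴴ)).trace.re else 0) +
      (if e.tgt = x then ((g : Matrix (Fin N) (Fin N) ℂ) * ((A e : Matrix (Fin N) (Fin N) ℂ)ᴴ *
          (ω e.1 : Matrix (Fin N) (Fin N) ℂ)ᴴ * (B e : Matrix (Fin N) (Fin N) ℂ))).trace.re else 0) +
      (if e.1 ≠ x ∧ e.tgt ≠ x then ((ω e.1 : Matrix (Fin N) (Fin N) ℂ) * (A e : Matrix (Fin N) (Fin N) ℂ) *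
          (ω e.tgt : Matrix (Fin N) (Fin N) ℂ)ᴴ * (B e : Matrix (Fin N) (Fin N) ℂ)ᴴ).trace.re else 0) := by
  by_cases h1 : e.1 = x
  · have h2 : e.tgt ≠ x := fun h => he (h.trans h1.symm)
    rw [if_pos h1, if_neg h2, if_neg (fun h => h.1 h1), add_zero, add_zero, ← h1, Function.update_self,
      Function.update_of_ne he]
    simp only [Matrix.mul_assoc]
  · by_cases h2 : e.tgt = x
    · rw [if_neg h1, if_pos h2, if_neg (fun h => h.2 h2), zero_add, add_zero, ← h2, Function.update_self,
        Function.update_of_ne (by rwa [h2])]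
      rw [← re_trace_conjTranspose]
      simp only [Matrix.conjTranspose_mul, Matrix.conjTranspose_conjTranspose, Matrix.mul_assoc]
      rw [Matrix.trace_mul_comm]
      simp only [Matrix.mul_assoc]
    · rw [if_neg h1, if_neg h2, if_pos ⟨h1, h2⟩, zero_add, zero_add, Function.update_of_ne h1,
        Function.update_of_ne h2]

/-- `Re tr(g · slabStapleSum) = ∑_{out} Re tr(g A_e ω^*_y B_e^*) + ∑_{in} Re tr(g A_e^* ω_y^* B_e)`. [folklore] -/
theorem re_trace_mul_slabStapleSum (A B : SlabEdge n L → Matrix.unitaryGroup (Fin N) ℂ) (ω : SlabConfig n L N)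
    (x : TorusSite n L) (g : SU N) :
    ((g : Matrix (Fin N) (Fin N) ℂ) * slabStapleSum A B ω x).trace.re =
      (∑ e ∈ outEdges x, ((g : Matrix (Fin N) (Fin N) ℂ) * ((A e : Matrix (Fin N) (Fin N) ℂ) *
          (ω e.tgt : Matrix (Fin N) (Fin N) ℂ)ᴴ * (B e : Matrix (Fin N) (Fin N) ℂ)ᴴ)).trace.re) +
      ∑ e ∈ inEdges x, ((g : Matrix (Fin N) (Fin N) ℂ) * ((A e : Matrix (Fin N) (Fin N) ℂ)ᴴ *
          (ω e.1 : Matrix (Fin N) (Fin N) ℂ)ᴴ * (B e : Matrix (Fin N) (Fin N) ℂ))).trace.re := by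
  simp only [slabStapleSum, Matrix.mul_add, Finset.mul_sum, Matrix.trace_add, Matrix.trace_sum, Complex.add_re,
    Complex.re_sum]

/-- **The slab energy is affine in one spin**: `S_{A,B}(ω^{x←g}) = R_x(ω) + N Re tr(g B_x(ω))` (no loops: `L ≠ 1`).
[folklore] -/
theorem slabEnergy_update (β : ℝ) (A B : SlabEdge n L → Matrix.unitaryGroup (Fin N) ℂ) (ω : SlabConfig n L N)
    (x : TorusSite n L) (g : SU N) (hL : ∀ e : SlabEdge n L, e.tgt ≠ e.1) :
    slabEnergy N β A B (Function.update ω x g) =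
      (N : ℝ) * β * (∑ e : SlabEdge n L, if e.1 ≠ x ∧ e.tgt ≠ x then
          ((ω e.1 : Matrix (Fin N) (Fin N) ℂ) * (A e : Matrix (Fin N) (Fin N) ℂ) *
            (ω e.tgt : Matrix (Fin N) (Fin N) ℂ)ᴴ * (B e : Matrix (Fin N) (Fin N) ℂ)ᴴ).trace.re else 0) +
      (N : ℝ) * (((g : Matrix (Fin N) (Fin N) ℂ) * slabField β A B ω x).trace.re) := by
  classical
  unfold slabEnergy
  rw [Finset.sum_congr rfl fun e _ => edgeTerm_update A B ω x g e (hL e), Finset.sum_add_distrib,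
    Finset.sum_add_distrib, ← Finset.sum_filter, ← Finset.sum_filter]
  rw [slabField, Matrix.mul_smul, Matrix.trace_smul, smul_eq_mul, Complex.re_ofReal_mul,
    re_trace_mul_slabStapleSum]
  simp only [outEdges, inEdges]
  ring

/-- **The one-site conditional law of the slab model in 't Hooft form**: `γ_x(· | ω) = Z⁻¹ exp(N Re tr(g B_x(ω))) dg`,
the SAME tilted-Haar family as the one-link law of the full lattice model (`siteLaw_ymSpecification_thooft`).
[cite: CaoNissimSheffield2025dynamical, Def. 2.1] -/
theorem siteLaw_slabSpec_thooft (β : ℝ) (A B : SlabEdge n L → Matrix.unitaryGroup (Fin N) ℂ)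
    (x : TorusSite n L) (ω : SlabConfig n L N) (hL : ∀ e : SlabEdge n L, e.tgt ≠ e.1) :
    siteLaw (slabSpec β A B) x ω =
      (haarProbability (SU N)).tilted fun g => (N : ℝ) * ((g : Matrix (Fin N) (Fin N) ℂ) * slabField β A B ω x).trace.re := by
  rw [siteLaw_slabSpec_eq_tilted]
  have : (fun g : SU N => slabEnergy N β A B (Function.update ω x g)) = fun g : SU N =>
      (N : ℝ) * β * (∑ e : SlabEdge n L, if e.1 ≠ x ∧ e.tgt ≠ x then
          ((ω e.1 : Matrix (Fin N) (Fin N) ℂ) * (A e : Matrix (Fin N) (Fin N) ℂ) *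
            (ω e.tgt : Matrix (Fin N) (Fin N) ℂ)ᴴ * (B e : Matrix (Fin N) (Fin N) ℂ)ᴴ).trace.re else 0) +
      (N : ℝ) * (((g : Matrix (Fin N) (Fin N) ℂ) * slabField β A B ω x).trace.re) :=
    funext fun g => slabEnergy_update β A B ω x g hL
  rw [this, tilted_const_add_eq]

/-! ### Size of the field and its Lipschitz dependence on the neighbouring spins -/

/-- Outgoing edges at `x` are determined by their direction. [folklore] -/
theorem card_outEdges_le (x : TorusSite n L) : (outEdges x).card ≤ n := by
  classical
  calc (outEdges x).card ≤ (Finset.univ : Finset (Fin n)).card :=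
        Finset.card_le_card_of_injOn (fun e => e.2) (fun _ _ => Finset.mem_univ _) (by
          intro e he e' he' h
          simp only [outEdges, Finset.coe_filter, Set.mem_setOf_eq] at he he'
          exact Prod.ext (he.2.trans he'.2.symm) h)
    _ = n := by simp

/-- Incoming edges at `x` are determined by their direction. [folklore] -/
theorem card_inEdges_le (x : TorusSite n L) : (inEdges x).card ≤ n := by
  classical
  calc (inEdges x).card ≤ (Finset.univ : Finset (Fin n)).card :=
        Finset.card_le_card_of_injOn (fun e => e.2) (fun _ _ => Finset.mem_univ _) (by
          intro e he e' he' h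
          have h' : e.2 = e'.2 := h
          simp only [inEdges, SlabEdge.tgt, Finset.coe_filter, Set.mem_setOf_eq] at he he'
          refine Prod.ext ?_ h'
          funext j
          have h1 := congrFun he.2 j
          have h2 := congrFun he'.2 j
          simp only [Function.update_apply] at h1 h2
          by_cases hj : j = e.2
          · subst hj
            rw [if_pos rfl] at h1; rw [← h', if_pos rfl] at h2
            exact add_right_cancel (h1.trans h2.symm)
          · rw [if_neg hj] at h1
            rw [if_neg (by rwa [← h'])] at h2
            exact h1.trans h2.symm)
    _ = n := by simp

omit [NeZero L] in
/-- Every summand of the slab staple sum is a unitary matrix. [folklore] -/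
theorem outTerm_mem_unitaryGroup (A B : SlabEdge n L → Matrix.unitaryGroup (Fin N) ℂ) (ω : SlabConfig n L N)
    (e : SlabEdge n L) :
    (A e : Matrix (Fin N) (Fin N) ℂ) * (ω e.tgt : Matrix (Fin N) (Fin N) ℂ)ᴴ * (B e : Matrix (Fin N) (Fin N) ℂ)ᴴ ∈
      Matrix.unitaryGroup (Fin N) ℂ :=
  Submonoid.mul_mem _ (Submonoid.mul_mem _ (A e).2 (su_conjTranspose_mem_unitaryGroup _))
    (OneLinkLaplace.conjTranspose_mem_unitaryGroup (B e).2)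

omit [NeZero L] in
/-- Every summand of the slab staple sum is a unitary matrix. [folklore] -/
theorem inTerm_mem_unitaryGroup (A B : SlabEdge n L → Matrix.unitaryGroup (Fin N) ℂ) (ω : SlabConfig n L N)
    (e : SlabEdge n L) :
    (A e : Matrix (Fin N) (Fin N) ℂ)ᴴ * (ω e.1 : Matrix (Fin N) (Fin N) ℂ)ᴴ * (B e : Matrix (Fin N) (Fin N) ℂ) ∈
      Matrix.unitaryGroup (Fin N) ℂ :=
  Submonoid.mul_mem _ (Submonoid.mul_mem _ (OneLinkLaplace.conjTranspose_mem_unitaryGroup (A e).2) (su_conjTranspose_mem_unitaryGroup _)) (B e).2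

/-- `‖B_x(ω)‖_op ≤ 2n|β|` (`2n = 2(d-1)` unitary terms): the SAME radius as the full model's staple field.
[folklore] -/
theorem matrixOpNorm_slabField_le (hN : 1 ≤ N) (β : ℝ) (A B : SlabEdge n L → Matrix.unitaryGroup (Fin N) ℂ)
    (ω : SlabConfig n L N) (x : TorusSite n L) :
    matrixOpNorm (slabField β A B ω x) ≤ |β| * (2 * (n : ℝ)) := by
  haveI : Nonempty (Fin N) := ⟨⟨0, hN⟩⟩
  rw [slabField, matrixOpNorm_smul, Complex.norm_real, Real.norm_eq_abs]
  refine mul_le_mul_of_nonneg_left ?_ (abs_nonneg β)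
  rw [slabStapleSum]
  refine (matrixOpNorm_add_le _ _).trans ?_
  have h1 : matrixOpNorm (∑ e ∈ outEdges x, (A e : Matrix (Fin N) (Fin N) ℂ) * (ω e.tgt : Matrix (Fin N) (Fin N) ℂ)ᴴ *
      (B e : Matrix (Fin N) (Fin N) ℂ)ᴴ) ≤ n := by
    refine (matrixOpNorm_sum_le _ _).trans ?_
    rw [Finset.sum_congr rfl fun e _ => matrixOpNorm_of_mem_unitaryGroup (outTerm_mem_unitaryGroup A B ω e),
      Finset.sum_const, nsmul_eq_mul, mul_one]
    exact_mod_cast card_outEdges_le x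
  have h2 : matrixOpNorm (∑ e ∈ inEdges x, (A e : Matrix (Fin N) (Fin N) ℂ)ᴴ * (ω e.1 : Matrix (Fin N) (Fin N) ℂ)ᴴ *
      (B e : Matrix (Fin N) (Fin N) ℂ)) ≤ n := by
    refine (matrixOpNorm_sum_le _ _).trans ?_
    rw [Finset.sum_congr rfl fun e _ => matrixOpNorm_of_mem_unitaryGroup (inTerm_mem_unitaryGroup A B ω e),
      Finset.sum_const, nsmul_eq_mul, mul_one]
    exact_mod_cast card_inEdges_le x
  linarith

/-- The **slab influence count** `m(x, y)`: number of edges joining `x` to `y` (either orientation). [folklore] -/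
def slabInfluence (x y : TorusSite n L) : ℕ :=
  ((outEdges x).filter fun e => e.tgt = y).card + ((inEdges x).filter fun e => e.1 = y).card

/-- **Lipschitz dependence of the slab staple sum on one neighbouring spin**: if `ω = η` off `y` then
`‖S_x(ω) − S_x(η)‖_F ≤ m(x,y) ‖ω_y − η_y‖_F` (unitary invariance of the Frobenius norm). [folklore] -/
theorem frobNorm_slabStapleSum_sub_le (A B : SlabEdge n L → Matrix.unitaryGroup (Fin N) ℂ) (x y : TorusSite n L)
    {ω η : SlabConfig n L N} (hωη : ∀ z, z ≠ y → ω z = η z) :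
    frobNorm (slabStapleSum A B ω x - slabStapleSum A B η x) ≤ slabInfluence x y * suFrobDist (ω y) (η y) := by
  classical
  have hsplit : slabStapleSum A B ω x - slabStapleSum A B η x =
      (∑ e ∈ outEdges x, ((A e : Matrix (Fin N) (Fin N) ℂ) * (ω e.tgt : Matrix (Fin N) (Fin N) ℂ)ᴴ *
          (B e : Matrix (Fin N) (Fin N) ℂ)ᴴ - (A e : Matrix (Fin N) (Fin N) ℂ) * (η e.tgt : Matrix (Fin N) (Fin N) ℂ)ᴴ *
          (B e : Matrix (Fin N) (Fin N) ℂ)ᴴ)) +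
      ∑ e ∈ inEdges x, ((A e : Matrix (Fin N) (Fin N) ℂ)ᴴ * (ω e.1 : Matrix (Fin N) (Fin N) ℂ)ᴴ *
          (B e : Matrix (Fin N) (Fin N) ℂ) - (A e : Matrix (Fin N) (Fin N) ℂ)ᴴ * (η e.1 : Matrix (Fin N) (Fin N) ℂ)ᴴ *
          (B e : Matrix (Fin N) (Fin N) ℂ)) := by
    simp only [slabStapleSum, Finset.sum_sub_distrib]; abel
  rw [hsplit]
  refine (frobNorm_add_le _ _).trans ?_
  rw [slabInfluence, Nat.cast_add, add_mul]
  refine add_le_add ?_ ?_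
  · refine (frobNorm_sum_le _ _).trans ?_
    rw [Finset.card_filter, Nat.cast_sum, Finset.sum_mul]
    refine Finset.sum_le_sum fun e _ => ?_
    by_cases h : e.tgt = y
    · rw [if_pos h, ← sub_mul, ← Matrix.mul_sub, frobNorm_mul_unitary _ (OneLinkLaplace.conjTranspose_mem_unitaryGroup (B e).2),
        frobNorm_unitary_mul (A e).2, ← Matrix.conjTranspose_sub, frobNorm_conjTranspose, h]
      simp [suFrobDist]
    · rw [hωη _ h, sub_self, frobNorm_zero, if_neg h]
      simp
  · refine (frobNorm_sum_le _ _).trans ?_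
    rw [Finset.card_filter, Nat.cast_sum, Finset.sum_mul]
    refine Finset.sum_le_sum fun e _ => ?_
    by_cases h : e.1 = y
    · rw [if_pos h, ← sub_mul, ← Matrix.mul_sub, frobNorm_mul_unitary _ (B e).2,
        frobNorm_unitary_mul (OneLinkLaplace.conjTranspose_mem_unitaryGroup (A e).2), ← Matrix.conjTranspose_sub, frobNorm_conjTranspose, h]
      simp [suFrobDist]
    · rw [hωη _ h, sub_self, frobNorm_zero, if_neg h]
      simp

/-- `‖B_x(ω) − B_x(η)‖_F ≤ |β| m(x,y) ‖ω_y − η_y‖_F` when `ω = η` off `y`. [folklore] -/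
theorem frobNorm_slabField_sub_le (β : ℝ) (A B : SlabEdge n L → Matrix.unitaryGroup (Fin N) ℂ) (x y : TorusSite n L)
    {ω η : SlabConfig n L N} (hωη : ∀ z, z ≠ y → ω z = η z) :
    frobNorm (slabField β A B ω x - slabField β A B η x) ≤ |β| * slabInfluence x y * suFrobDist (ω y) (η y) := by
  rw [slabField, slabField, ← smul_sub, frobNorm_smul, Complex.norm_real, Real.norm_eq_abs, mul_assoc]
  exact mul_le_mul_of_nonneg_left (frobNorm_slabStapleSum_sub_le A B x y hωη) (abs_nonneg β)

end Summit.Ventures.YMGap.Slab
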